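import Literature.MathematicalPhysics.QuantumFieldTheory.TorusSiteRP
import HarnessLib

/-!
# Reflection positivity of the Wilson action on the odd torus: the mixed reflection

On the odd torus `(ℤ/Lℤ)^d`, `L = 2n + 1`, Wave 0's reflection `θ t = 1 - t`
(`GaugeConfig.timeReflect`) has one fixed hyperplane **between** lattice planes (`t = ½`, crossed
by the time-like links `0 → 1`) and one fixed **lattice** hyperplane (`t = n + 1`). This file
provides the bookkeeping of Osterwalder–Seiler reflection positivity in this mixed situation
(the abstract mechanism with a shared block and crossing links is the tree's
`LatticeRP.integral_mul_conj_mul_exp_nonneg_of_shared`, drawn upon through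
`LatticeRP.re_sum_pair_sq_le`), for use by the Wilson-loop inequalities on odd tori
(`TorusOddLoops`, feeding `StringTension.hasStringTension_of_eventually` and the named fact
`exists_hasStringTension`):

* the blocks: positive links `P` (`1 ≤ t ≤ n` for both link types), crossing links `C`
  (time-like, `t = 0`), shared links `M` (spatial, `t = n + 1`); `Θ` fixes `M`
  (`timeReflect_apply_of_mem_M_odd`), the `P ∪ C`-coordinates of `ΘU` live off `P`
  (`dependsOn_timeReflect_apply_odd`);
* the splitting of the lower crossing links only, `V = tL(Y, U)`, `V_e = U_e Y_e` on `C`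
  (written as an explicit lambda; measure preserving, `measurePreserving_translateLower`);
* the plaquettes: positive (`1 ≤ t ≤ n`), crossing (time-like at `t = 0`), shared (spatial at
  `t = n + 1`) and negative ones, `ϑ = WilsonRP.plaqReflect` exchanging positive and negative
  (`sum_neg_eq_sum_pos_odd`), the split
  `∑ₚ Re tr ρ(U_p) = A(U) + A(ΘU) + X(U) + A_M(U)` (`sum_plaqRe_eq_odd`) and its behaviour under
  `tL` (`sumPos_translateLower`, …);
* the Gram form of the crossing Boltzmann weight after the splitting
  (`plaqRe_translateLower_of_cross`, `sum_coeffLower_mul_conj`) with the coefficient functions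
  written explicitly, and their measurability / bounds / dependence.

Everything here is proved; there are no definitions (blocks and maps are explicit expressions).

## References

* K. Osterwalder, E. Seiler, Ann. Phys. 110 (1978) 440, §2; E. Seiler, LNP 159 (1982), §2.
* C. Borgs, E. Seiler, Commun. Math. Phys. 91 (1983) 329, §II.2 (reflection positivity "both in
  lattice planes and in planes lying half-way between lattice planes").
-/

noncomputable section

open MeasureTheory Finset Complex
open scoped ComplexOrder ComplexConjugate

namespace Literature.MathematicalPhysics.QuantumFieldTheory

namespace StringTension

open WilsonRP LatticeRP Literature.RepresentationTheory.CompactGroups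

variable {d L N : ℕ} [NeZero d] [NeZero L] [Fact (1 < L)]
variable {G : Type*} [Group G] [TopologicalSpace G] [IsTopologicalGroup G] [CompactSpace G]
  [MeasurableSpace G] [BorelSpace G]
variable (ρ : G →* Matrix (Fin N) (Fin N) ℂ)

/-! ### Arithmetic of the odd torus -/

section Odd

omit [NeZero L] [Fact (1 < L)] in
/-- `L = 2 (L/2) + 1` for odd `L`. [folklore] -/
theorem two_mul_div_two_add_one_of_odd (hL : Odd L) : 2 * (L / 2) + 1 = L := by
  have := Nat.odd_iff.mp hL; omega

omit [NeZero L] [Fact (1 < L)] in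
/-- The lattice plane `t = L/2 + 1` is fixed by `θ t = 1 - t` on the odd torus:
`2 (L/2 + 1) = 1` in `ZMod L`. [folklore] -/
theorem cast_half_succ_add_self (hL : Odd L) :
    (((L / 2 + 1 : ℕ)) : ZMod L) + (((L / 2 + 1 : ℕ)) : ZMod L) = 1 := by
  rw [← Nat.cast_add, show L / 2 + 1 + (L / 2 + 1) = L + 1 by have := Nat.odd_iff.mp hL; omega,
    Nat.cast_add, ZMod.natCast_self, zero_add, Nat.cast_one]

omit [Fact (1 < L)] in
/-- A site of the plane `t = L/2 + 1` satisfies `t + t = 1`. [folklore] -/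
theorem add_self_eq_one_of_val (hL : Odd L) {x : Site d L} (h : (x 0).val = L / 2 + 1) :
    x 0 + x 0 = 1 := by
  rw [← ZMod.natCast_zmod_val (x 0), h]
  exact cast_half_succ_add_self hL

omit [NeZero L] [Fact (1 < L)] in
/-- For `t + t = 1`: `θ x = x`. [folklore] -/
theorem timeReflect_of_add_self_eq_one {x : Site d L} (h : x 0 + x 0 = 1) : x.timeReflect = x := by
  funext k
  by_cases hk : k = 0
  · subst hk
    rw [WilsonRP.timeReflect_apply_zero]
    linear_combination -h
  · exact WilsonRP.timeReflect_apply_of_ne x hk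

end Odd

/-! ### The blocks `P`, `C`, `M` -/

section Blocks

omit [Fact (1 < L)] [TopologicalSpace G] [IsTopologicalGroup G] [CompactSpace G] [MeasurableSpace G]
  [BorelSpace G] in
/-- **`Θ` fixes the shared block `M`** (spatial links in the plane `t = L/2 + 1`). [folklore] -/
theorem timeReflect_apply_of_mem_M_odd (hL : Odd L) (U : GaugeConfig d L G) (e : Edge d L)
    (he : e ∈ (Finset.univ.filter fun e : Edge d L =>
      Prod.snd e ≠ 0 ∧ ZMod.val (Prod.fst e 0) = L / 2 + 1)) :
    U.timeReflect e = U e := by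
  obtain ⟨x, i⟩ := e
  rw [Finset.mem_filter] at he
  obtain ⟨-, hi, ht⟩ := he
  simp only at hi ht
  rw [timeReflect_apply]
  simp only [hi, ↓reduceIte, edgeReflect, timeReflect_of_add_self_eq_one (add_self_eq_one_of_val hL ht)]

omit [TopologicalSpace G] [IsTopologicalGroup G] [CompactSpace G] [MeasurableSpace G] [BorelSpace G] in
/-- **The `P ∪ C`-coordinates of `ΘU` are determined off `P`** on the odd torus. [folklore] -/
theorem dependsOn_timeReflect_apply_odd (hL : Odd L) (e : Edge d L)
    (he : e ∈ (Finset.univ.filter fun e : Edge d L =>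
        1 ≤ ZMod.val (Prod.fst e 0) ∧ ZMod.val (Prod.fst e 0) ≤ L / 2) ∪
      (Finset.univ.filter fun e : Edge d L => Prod.snd e = 0 ∧ ZMod.val (Prod.fst e 0) = 0)) :
    DependsOn (fun U : GaugeConfig d L G => U.timeReflect e)
      (((Finset.univ.filter fun e : Edge d L =>
        1 ≤ ZMod.val (Prod.fst e 0) ∧ ZMod.val (Prod.fst e 0) ≤ L / 2)ᶜ : Finset (Edge d L)) :
          Set (Edge d L)) := by
  obtain ⟨x, i⟩ := e
  have h1L : 1 < L := Fact.out
  have hO := Nat.odd_iff.mp hL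
  have hlt := ZMod.val_lt (x 0)
  rw [Finset.mem_union, Finset.mem_filter, Finset.mem_filter] at he
  simp only [Finset.mem_univ, true_and] at he
  intro U V hUV
  simp only [timeReflect_apply]
  have key : edgeReflect ((x, i) : Edge d L) ∈
      (((Finset.univ.filter fun e : Edge d L =>
        1 ≤ ZMod.val (Prod.fst e 0) ∧ ZMod.val (Prod.fst e 0) ≤ L / 2)ᶜ : Finset (Edge d L)) :
          Set (Edge d L)) := by
    rw [Finset.mem_coe, Finset.mem_compl, Finset.mem_filter]
    simp only [Finset.mem_univ, true_and, not_and, not_le]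
    unfold edgeReflect
    by_cases hi : i = 0
    · subst hi
      simp only [↓reduceIte]
      rw [val_timeReflect_shift_zero]
      intro h1
      split_ifs at h1 ⊢ <;> omega
    · simp only [hi, ↓reduceIte]
      rw [val_timeReflect]
      intro h1
      rcases he with he | he
      · split_ifs at h1 ⊢ <;> omega
      · exact absurd he.1 hi
  rw [hUV _ key]

omit [Fact (1 < L)] in
/-- The shared block is disjoint from the positive block. [folklore] -/
theorem disjoint_M_P_odd :
    Disjoint (Finset.univ.filter fun e : Edge d L => Prod.snd e ≠ 0 ∧ ZMod.val (Prod.fst e 0) = L / 2 + 1)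
      (Finset.univ.filter fun e : Edge d L =>
        1 ≤ ZMod.val (Prod.fst e 0) ∧ ZMod.val (Prod.fst e 0) ≤ L / 2) := by
  rw [Finset.disjoint_left]
  intro e hM hP
  rw [Finset.mem_filter] at hM hP
  omega

omit [Fact (1 < L)] in
/-- The shared block is disjoint from the crossing block. [folklore] -/
theorem disjoint_M_C_odd :
    Disjoint (Finset.univ.filter fun e : Edge d L => Prod.snd e ≠ 0 ∧ ZMod.val (Prod.fst e 0) = L / 2 + 1)
      (Finset.univ.filter fun e : Edge d L => Prod.snd e = 0 ∧ ZMod.val (Prod.fst e 0) = 0) := by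
  rw [Finset.disjoint_left]
  intro e hM hC
  rw [Finset.mem_filter] at hM hC
  exact hM.2.1 hC.2.1

end Blocks

/-! ### Splitting the lower crossing links: `tL(Y, U)` -/

section TranslateLower

omit [NeZero L] [Fact (1 < L)] [TopologicalSpace G] [IsTopologicalGroup G] [CompactSpace G]
  [MeasurableSpace G] [BorelSpace G] in
/-- `tL(Y, U)` on a crossing link: `U_e Y_e`. [folklore] -/
theorem translateLower_apply_of_cross (Y U : GaugeConfig d L G) {e : Edge d L}
    (he : Prod.snd e = 0 ∧ ZMod.val (Prod.fst e 0) = 0) :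
    (fun e' : Edge d L => U e' * (if Prod.snd e' = 0 ∧ ZMod.val (Prod.fst e' 0) = 0 then Y e' else 1)) e =
      U e * Y e := by
  simp only [if_pos he]

omit [NeZero L] [Fact (1 < L)] [TopologicalSpace G] [IsTopologicalGroup G] [CompactSpace G]
  [MeasurableSpace G] [BorelSpace G] in
/-- `tL(Y, U)` off the crossing links: `U_e`. [folklore] -/
theorem translateLower_apply_of_not_cross (Y U : GaugeConfig d L G) {e : Edge d L}
    (he : ¬ (Prod.snd e = 0 ∧ ZMod.val (Prod.fst e 0) = 0)) :
    (fun e' : Edge d L => U e' * (if Prod.snd e' = 0 ∧ ZMod.val (Prod.fst e' 0) = 0 then Y e' else 1)) e =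
      U e := by
  simp only [if_neg he, mul_one]

omit [NeZero L] [Fact (1 < L)] [TopologicalSpace G] [IsTopologicalGroup G] [CompactSpace G]
  [MeasurableSpace G] [BorelSpace G] in
/-- `tL(Y, U)` does not change spatial links. [folklore] -/
theorem translateLower_apply_of_ne_zero (Y U : GaugeConfig d L G) {e : Edge d L} (he : e.2 ≠ 0) :
    (fun e' : Edge d L => U e' * (if Prod.snd e' = 0 ∧ ZMod.val (Prod.fst e' 0) = 0 then Y e' else 1)) e =
      U e :=
  translateLower_apply_of_not_cross Y U fun h => he h.1

omit [Fact (1 < L)] in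
/-- **`tL(Y, ·)` preserves the product Haar measure** (right invariance of Haar measure on the
compact group). [folklore] -/
theorem measurePreserving_translateLower (Y : GaugeConfig d L G) :
    MeasurePreserving (fun U : GaugeConfig d L G => fun e : Edge d L =>
        U e * (if Prod.snd e = 0 ∧ ZMod.val (Prod.fst e 0) = 0 then Y e else 1))
      (LatticeRP.piMeasure (haarProbability G)) (LatticeRP.piMeasure (haarProbability G)) :=
  measurePreserving_pi _ _ fun _ => measurePreserving_mul_right (haarProbability G) _

omit [Fact (1 < L)] [Group G] [TopologicalSpace G] [IsTopologicalGroup G] [CompactSpace G]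
  [MeasurableSpace G] [BorelSpace G] in
/-- The spliced configuration on a crossing link. [folklore] -/
theorem spliceLower_apply_of_cross (U Y : GaugeConfig d L G) {e : Edge d L}
    (he : Prod.snd e = 0 ∧ ZMod.val (Prod.fst e 0) = 0) :
    LatticeRP.splice (Finset.univ.filter fun e : Edge d L => Prod.snd e = 0 ∧ ZMod.val (Prod.fst e 0) = 0)
      (U, Y) e = Y e := by
  rw [LatticeRP.splice_apply, if_pos (show e ∈ Finset.univ.filter (fun e : Edge d L =>
      Prod.snd e = 0 ∧ ZMod.val (Prod.fst e 0) = 0) from Finset.mem_filter.2 ⟨Finset.mem_univ _, he⟩)]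

omit [Fact (1 < L)] [Group G] [TopologicalSpace G] [IsTopologicalGroup G] [CompactSpace G]
  [MeasurableSpace G] [BorelSpace G] in
/-- The spliced configuration off the crossing links. [folklore] -/
theorem spliceLower_apply_of_not_cross (U Y : GaugeConfig d L G) {e : Edge d L}
    (he : ¬ (Prod.snd e = 0 ∧ ZMod.val (Prod.fst e 0) = 0)) :
    LatticeRP.splice (Finset.univ.filter fun e : Edge d L => Prod.snd e = 0 ∧ ZMod.val (Prod.fst e 0) = 0)
      (U, Y) e = U e := by
  rw [LatticeRP.splice_apply, if_neg (show ¬ e ∈ Finset.univ.filter (fun e : Edge d L =>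
      Prod.snd e = 0 ∧ ZMod.val (Prod.fst e 0) = 0) from fun h => he (Finset.mem_filter.1 h).2)]

end TranslateLower

/-! ### The plaquettes of the odd torus under `Θ` and the split of the action -/

section Plaquettes

/-- **`ϑ` maps positive plaquettes (`1 ≤ t ≤ L/2`) to negative ones** on the odd torus
(`neg = ¬pos ∧ ¬cross ∧ ¬shared`). [folklore] -/
theorem neg_plaqReflect_of_pos_odd (hL : Odd L) {p : Plaquette d L}
    (hp : 1 ≤ (p.1 0).val ∧ (p.1 0).val ≤ L / 2) :
    (¬ (1 ≤ ((plaqReflect p).1 0).val ∧ ((plaqReflect p).1 0).val ≤ L / 2) ∧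
      ¬ ((plaqReflect p).2.1.1 = 0 ∧ ((plaqReflect p).1 0).val = 0)) ∧
      ¬ ((plaqReflect p).2.1.1 ≠ 0 ∧ ((plaqReflect p).1 0).val = L / 2 + 1) := by
  have h1L : 1 < L := Fact.out
  have hO := Nat.odd_iff.mp hL
  have hlt := ZMod.val_lt (p.1 0)
  unfold plaqReflect
  by_cases hi : p.2.1.1 = 0
  · simp only [hi, ↓reduceIte, true_and, ne_eq, not_true_eq_false, false_and, not_false_eq_true,
      and_true]
    rw [val_timeReflect_shift_zero]
    split_ifs <;> (try simp only [not_true_eq_false, and_false]) <;> omega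
  · simp only [hi, ↓reduceIte, false_and, not_false_eq_true, and_true, ne_eq, true_and]
    rw [val_timeReflect]
    split_ifs <;> (try simp only [not_false_eq_true, and_true]) <;> omega

/-- **`ϑ` maps negative plaquettes to positive ones** on the odd torus. [folklore] -/
theorem pos_plaqReflect_of_neg_odd (hL : Odd L) {p : Plaquette d L}
    (hp : (¬ (1 ≤ (p.1 0).val ∧ (p.1 0).val ≤ L / 2) ∧ ¬ (p.2.1.1 = 0 ∧ (p.1 0).val = 0)) ∧
      ¬ (p.2.1.1 ≠ 0 ∧ (p.1 0).val = L / 2 + 1)) :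
    1 ≤ ((plaqReflect p).1 0).val ∧ ((plaqReflect p).1 0).val ≤ L / 2 := by
  have h1L : 1 < L := Fact.out
  have hO := Nat.odd_iff.mp hL
  have hlt := ZMod.val_lt (p.1 0)
  obtain ⟨⟨hnp, hnc⟩, hnm⟩ := hp
  unfold plaqReflect
  by_cases hi : p.2.1.1 = 0
  · simp only [hi, ↓reduceIte]
    have h0 : (p.1 0).val ≠ 0 := fun h => hnc ⟨hi, h⟩
    rw [val_timeReflect_shift_zero, if_neg h0]
    omega
  · simp only [hi, ↓reduceIte]
    have hm : (p.1 0).val ≠ L / 2 + 1 := fun h => hnm ⟨hi, h⟩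
    rw [val_timeReflect]
    split_ifs <;> omega

omit [MeasurableSpace G] [BorelSpace G] in
/-- **The negative part of the action is the positive part of the reflected configuration** on
the odd torus: `∑_{neg} Re tr ρ(U_p) = ∑_{pos} Re tr ρ((ΘU)_p)`. [folklore] -/
theorem sum_neg_eq_sum_pos_odd (hL : Odd L) (hρ : Continuous ρ) (U : GaugeConfig d L G) :
    ∑ p ∈ Finset.univ.filter (fun p : Plaquette d L =>
        (¬ (1 ≤ ZMod.val (Prod.fst p 0) ∧ ZMod.val (Prod.fst p 0) ≤ L / 2) ∧
          ¬ (Prod.fst (Subtype.val (Prod.snd p)) = 0 ∧ ZMod.val (Prod.fst p 0) = 0)) ∧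
        ¬ (Prod.fst (Subtype.val (Prod.snd p)) ≠ 0 ∧ ZMod.val (Prod.fst p 0) = L / 2 + 1)), plaqRe ρ U p =
      ∑ p ∈ Finset.univ.filter (fun p : Plaquette d L =>
        1 ≤ ZMod.val (Prod.fst p 0) ∧ ZMod.val (Prod.fst p 0) ≤ L / 2), plaqRe ρ U.timeReflect p := by
  simp_rw [plaqRe_timeReflect ρ hρ]
  symm
  refine Finset.sum_equiv plaqReflectEquiv (fun p => ?_) (fun p _ => rfl)
  simp only [Finset.mem_filter, Finset.mem_univ, true_and]
  constructor
  · intro hp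
    exact neg_plaqReflect_of_pos_odd hL hp
  · intro hp
    have := pos_plaqReflect_of_neg_odd hL (p := plaqReflectEquiv p) hp
    rwa [show plaqReflect (plaqReflectEquiv p) = p from plaqReflect_plaqReflect p] at this

omit [NeZero L] [Fact (1 < L)] in
/-- Crossing plaquettes are not positive. [folklore] -/
theorem not_pos_of_cross_odd (p : Plaquette d L) (h : p.2.1.1 = 0 ∧ (p.1 0).val = 0) :
    ¬ (1 ≤ (p.1 0).val ∧ (p.1 0).val ≤ L / 2) := by
  omega

omit [NeZero L] [Fact (1 < L)] in
/-- Shared plaquettes are neither positive nor crossing. [folklore] -/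
theorem not_pos_not_cross_of_shared_odd (p : Plaquette d L)
    (h : p.2.1.1 ≠ 0 ∧ (p.1 0).val = L / 2 + 1) :
    ¬ (1 ≤ (p.1 0).val ∧ (p.1 0).val ≤ L / 2) ∧ ¬ (p.2.1.1 = 0 ∧ (p.1 0).val = 0) := by
  obtain ⟨hi, ht⟩ := h
  exact ⟨by omega, fun h' => hi h'.1⟩

omit [MeasurableSpace G] [BorelSpace G] in
/-- **Split of the action on the odd torus**:
`∑ₚ Re tr ρ(U_p) = A(U) + A(ΘU) + X(U) + A_M(U)` with `A` the sum over positive plaquettes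
(`1 ≤ t ≤ L/2`), `X` over the crossing plaquettes (time-like, `t = 0`) and `A_M` over the shared
ones (spatial, `t = L/2 + 1`). [folklore] -/
theorem sum_plaqRe_eq_odd (hL : Odd L) (hρ : Continuous ρ) (U : GaugeConfig d L G) :
    ∑ p, plaqRe ρ U p =
      (∑ p ∈ Finset.univ.filter (fun p : Plaquette d L =>
          1 ≤ ZMod.val (Prod.fst p 0) ∧ ZMod.val (Prod.fst p 0) ≤ L / 2), plaqRe ρ U p) +
      (∑ p ∈ Finset.univ.filter (fun p : Plaquette d L =>
          1 ≤ ZMod.val (Prod.fst p 0) ∧ ZMod.val (Prod.fst p 0) ≤ L / 2), plaqRe ρ U.timeReflect p) +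
      (∑ p ∈ Finset.univ.filter (fun p : Plaquette d L =>
          Prod.fst (Subtype.val (Prod.snd p)) = 0 ∧ ZMod.val (Prod.fst p 0) = 0), plaqRe ρ U p) +
      (∑ p ∈ Finset.univ.filter (fun p : Plaquette d L =>
          Prod.fst (Subtype.val (Prod.snd p)) ≠ 0 ∧ ZMod.val (Prod.fst p 0) = L / 2 + 1), plaqRe ρ U p) := by
  rw [← Finset.sum_filter_add_sum_filter_not Finset.univ
      (fun p : Plaquette d L => 1 ≤ ZMod.val (Prod.fst p 0) ∧ ZMod.val (Prod.fst p 0) ≤ L / 2),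
    ← Finset.sum_filter_add_sum_filter_not
      (Finset.univ.filter fun p : Plaquette d L =>
        ¬ (1 ≤ ZMod.val (Prod.fst p 0) ∧ ZMod.val (Prod.fst p 0) ≤ L / 2))
      (fun p : Plaquette d L => Prod.fst (Subtype.val (Prod.snd p)) = 0 ∧ ZMod.val (Prod.fst p 0) = 0),
    Finset.filter_filter, Finset.filter_filter,
    ← Finset.sum_filter_add_sum_filter_not
      (Finset.univ.filter fun p : Plaquette d L =>
        ¬ (1 ≤ ZMod.val (Prod.fst p 0) ∧ ZMod.val (Prod.fst p 0) ≤ L / 2) ∧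
          ¬ (Prod.fst (Subtype.val (Prod.snd p)) = 0 ∧ ZMod.val (Prod.fst p 0) = 0))
      (fun p : Plaquette d L => Prod.fst (Subtype.val (Prod.snd p)) ≠ 0 ∧ ZMod.val (Prod.fst p 0) = L / 2 + 1),
    Finset.filter_filter, Finset.filter_filter, sum_neg_eq_sum_pos_odd ρ hL hρ U]
  have hC : (Finset.univ.filter fun p : Plaquette d L =>
      ¬ (1 ≤ ZMod.val (Prod.fst p 0) ∧ ZMod.val (Prod.fst p 0) ≤ L / 2) ∧
        (Prod.fst (Subtype.val (Prod.snd p)) = 0 ∧ ZMod.val (Prod.fst p 0) = 0)) =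
      Finset.univ.filter fun p : Plaquette d L =>
        Prod.fst (Subtype.val (Prod.snd p)) = 0 ∧ ZMod.val (Prod.fst p 0) = 0 :=
    Finset.filter_congr fun p _ => ⟨fun h => h.2, fun h => ⟨not_pos_of_cross_odd p h, h⟩⟩
  have hM : (Finset.univ.filter fun p : Plaquette d L =>
      (¬ (1 ≤ ZMod.val (Prod.fst p 0) ∧ ZMod.val (Prod.fst p 0) ≤ L / 2) ∧
        ¬ (Prod.fst (Subtype.val (Prod.snd p)) = 0 ∧ ZMod.val (Prod.fst p 0) = 0)) ∧
        (Prod.fst (Subtype.val (Prod.snd p)) ≠ 0 ∧ ZMod.val (Prod.fst p 0) = L / 2 + 1)) =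
      Finset.univ.filter fun p : Plaquette d L =>
        Prod.fst (Subtype.val (Prod.snd p)) ≠ 0 ∧ ZMod.val (Prod.fst p 0) = L / 2 + 1 :=
    Finset.filter_congr fun p _ => ⟨fun h => h.2, fun h => ⟨not_pos_not_cross_of_shared_odd p h, h⟩⟩
  rw [hC, hM]
  ring

omit [MeasurableSpace G] [BorelSpace G] in
/-- **`S = N·#plaquettes - A - A ∘ Θ - X - A_M`** on the odd torus. [folklore] -/
theorem wilsonAction_split_odd (hL : Odd L) (hρ : Continuous ρ) (U : GaugeConfig d L G) :
    wilsonAction ρ U = N * Fintype.card (Plaquette d L) -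
      ((∑ p ∈ Finset.univ.filter (fun p : Plaquette d L =>
          1 ≤ ZMod.val (Prod.fst p 0) ∧ ZMod.val (Prod.fst p 0) ≤ L / 2), plaqRe ρ U p) +
      (∑ p ∈ Finset.univ.filter (fun p : Plaquette d L =>
          1 ≤ ZMod.val (Prod.fst p 0) ∧ ZMod.val (Prod.fst p 0) ≤ L / 2), plaqRe ρ U.timeReflect p) +
      (∑ p ∈ Finset.univ.filter (fun p : Plaquette d L =>
          Prod.fst (Subtype.val (Prod.snd p)) = 0 ∧ ZMod.val (Prod.fst p 0) = 0), plaqRe ρ U p) +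
      (∑ p ∈ Finset.univ.filter (fun p : Plaquette d L =>
          Prod.fst (Subtype.val (Prod.snd p)) ≠ 0 ∧ ZMod.val (Prod.fst p 0) = L / 2 + 1), plaqRe ρ U p)) := by
  rw [wilsonAction_eq, sum_plaqRe_eq_odd ρ hL hρ]

end Plaquettes


/-! ### Plaquette variables off the crossing links -/

section OffCross

omit [NeZero L] [Fact (1 < L)] [TopologicalSpace G] [IsTopologicalGroup G] [CompactSpace G]
  [MeasurableSpace G] [BorelSpace G] in
/-- **A plaquette that is not a crossing plaquette has no crossing link**: its variable is
unchanged when the configuration is changed on the crossing links only. [folklore] -/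
theorem plaqRe_congr_off_cross {p : Plaquette d L} (hp : ¬ (p.2.1.1 = 0 ∧ (p.1 0).val = 0))
    {V V' : GaugeConfig d L G}
    (hVV' : ∀ e : Edge d L, ¬ (Prod.snd e = 0 ∧ ZMod.val (Prod.fst e 0) = 0) → V e = V' e) :
    plaqRe ρ V p = plaqRe ρ V' p := by
  obtain ⟨x, ⟨⟨i, j⟩, hij⟩⟩ := p
  have hj : j ≠ 0 := plaq_snd_ne_zero (x, ⟨(i, j), hij⟩)
  simp only at hp hj
  unfold plaqRe plaquetteHolonomy
  simp only
  have hxj : ((x.shift j) 0).val = (x 0).val := val_shift_of_ne x (Ne.symm hj)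
  by_cases hi : i = 0
  · subst hi
    have ht : (x 0).val ≠ 0 := fun h => hp ⟨rfl, h⟩
    rw [hVV' (x, 0) (fun h => ht h.2), hVV' (x.shift 0, j) (fun h => hj h.1),
      hVV' (x.shift j, 0) (fun h => ht (hxj ▸ h.2)), hVV' (x, j) (fun h => hj h.1)]
  · rw [hVV' (x, i) (fun h => hi h.1), hVV' (x.shift i, j) (fun h => hj h.1),
      hVV' (x.shift j, i) (fun h => hi h.1), hVV' (x, j) (fun h => hj h.1)]

omit [Fact (1 < L)] [TopologicalSpace G] [IsTopologicalGroup G] [CompactSpace G]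
  [MeasurableSpace G] [BorelSpace G] in
/-- Positive plaquettes (`1 ≤ t`) are unchanged by a change on the crossing links. [folklore] -/
theorem sumPos_congr_off_cross {V V' : GaugeConfig d L G}
    (hVV' : ∀ e : Edge d L, ¬ (Prod.snd e = 0 ∧ ZMod.val (Prod.fst e 0) = 0) → V e = V' e) :
    ∑ p ∈ Finset.univ.filter (fun p : Plaquette d L =>
        1 ≤ ZMod.val (Prod.fst p 0) ∧ ZMod.val (Prod.fst p 0) ≤ L / 2), plaqRe ρ V p =
      ∑ p ∈ Finset.univ.filter (fun p : Plaquette d L =>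
        1 ≤ ZMod.val (Prod.fst p 0) ∧ ZMod.val (Prod.fst p 0) ≤ L / 2), plaqRe ρ V' p := by
  refine Finset.sum_congr rfl fun p hp => plaqRe_congr_off_cross ρ ?_ hVV'
  rw [Finset.mem_filter] at hp
  omega

omit [Fact (1 < L)] [TopologicalSpace G] [IsTopologicalGroup G] [CompactSpace G]
  [MeasurableSpace G] [BorelSpace G] in
/-- Shared plaquettes (spatial) are unchanged by a change on the crossing links. [folklore] -/
theorem sumM_congr_off_cross {V V' : GaugeConfig d L G}
    (hVV' : ∀ e : Edge d L, ¬ (Prod.snd e = 0 ∧ ZMod.val (Prod.fst e 0) = 0) → V e = V' e) :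
    ∑ p ∈ Finset.univ.filter (fun p : Plaquette d L =>
        Prod.fst (Subtype.val (Prod.snd p)) ≠ 0 ∧ ZMod.val (Prod.fst p 0) = L / 2 + 1), plaqRe ρ V p =
      ∑ p ∈ Finset.univ.filter (fun p : Plaquette d L =>
        Prod.fst (Subtype.val (Prod.snd p)) ≠ 0 ∧ ZMod.val (Prod.fst p 0) = L / 2 + 1), plaqRe ρ V' p := by
  refine Finset.sum_congr rfl fun p hp => plaqRe_congr_off_cross ρ ?_ hVV'
  rw [Finset.mem_filter] at hp
  exact fun h => hp.2.1 h.1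

omit [NeZero L] [Fact (1 < L)] [TopologicalSpace G] [IsTopologicalGroup G] [CompactSpace G]
  [MeasurableSpace G] [BorelSpace G] in
/-- `tL(Y, U)` agrees with `U` off the crossing links. [folklore] -/
theorem translateLower_agree_off_cross (Y U : GaugeConfig d L G) :
    ∀ e : Edge d L, ¬ (Prod.snd e = 0 ∧ ZMod.val (Prod.fst e 0) = 0) →
      (fun e' : Edge d L => U e' * (if Prod.snd e' = 0 ∧ ZMod.val (Prod.fst e' 0) = 0 then Y e' else 1)) e =
        U e :=
  fun _ he => translateLower_apply_of_not_cross Y U he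

omit [Fact (1 < L)] [Group G] [TopologicalSpace G] [IsTopologicalGroup G] [CompactSpace G]
  [MeasurableSpace G] [BorelSpace G] in
/-- `splice_C(U, Y)` agrees with `U` off the crossing links. [folklore] -/
theorem spliceLower_agree_off_cross (U Y : GaugeConfig d L G) :
    ∀ e : Edge d L, ¬ (Prod.snd e = 0 ∧ ZMod.val (Prod.fst e 0) = 0) →
      LatticeRP.splice (Finset.univ.filter fun e : Edge d L => Prod.snd e = 0 ∧ ZMod.val (Prod.fst e 0) = 0)
        (U, Y) e = U e :=
  fun _ he => spliceLower_apply_of_not_cross U Y he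

omit [TopologicalSpace G] [IsTopologicalGroup G] [CompactSpace G] [MeasurableSpace G] [BorelSpace G] in
/-- **The reflections of `tL(Y, U)` and of `U` agree on the non-crossing plaquettes' mirror
images**: `(Θ tL(Y,U))_e = (ΘU)_e` whenever the mirror link of `e` is not crossing, in
particular on all links of positive plaquettes. Stated as: the two reflected configurations
agree off the links whose mirror is crossing, i.e. off `{e : θ-image of e is crossing}`; we
only need the consequence for positive plaquettes (`1 ≤ t ≤ L/2`). [folklore] -/
theorem sumPos_timeReflect_translateLower (Y U : GaugeConfig d L G) :
    ∑ p ∈ Finset.univ.filter (fun p : Plaquette d L =>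
        1 ≤ ZMod.val (Prod.fst p 0) ∧ ZMod.val (Prod.fst p 0) ≤ L / 2),
        plaqRe ρ (GaugeConfig.timeReflect (fun e' : Edge d L =>
          U e' * (if Prod.snd e' = 0 ∧ ZMod.val (Prod.fst e' 0) = 0 then Y e' else 1))) p =
      ∑ p ∈ Finset.univ.filter (fun p : Plaquette d L =>
        1 ≤ ZMod.val (Prod.fst p 0) ∧ ZMod.val (Prod.fst p 0) ≤ L / 2), plaqRe ρ U.timeReflect p := by
  have h1L : 1 < L := Fact.out
  set V : GaugeConfig d L G := (fun e' : Edge d L =>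
    U e' * (if Prod.snd e' = 0 ∧ ZMod.val (Prod.fst e' 0) = 0 then Y e' else 1)) with hV
  refine Finset.sum_congr rfl fun p hp => ?_
  rw [Finset.mem_filter] at hp
  obtain ⟨-, ht1, ht2⟩ := hp
  obtain ⟨x, ⟨⟨i, j⟩, hij⟩⟩ := p
  have hj : j ≠ 0 := plaq_snd_ne_zero (x, ⟨(i, j), hij⟩)
  have hlt := ZMod.val_lt (x 0)
  simp only at ht1 ht2 hj
  -- the reflected configurations agree on a link whose mirror is not crossing
  have hagree : ∀ e : Edge d L, ¬ (Prod.snd (edgeReflect e) = 0 ∧ ZMod.val (Prod.fst (edgeReflect e) 0) = 0) →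
      V.timeReflect e = U.timeReflect e := by
    intro e he
    have hVe : V (edgeReflect e) = U (edgeReflect e) := by
      rw [hV]; exact translateLower_apply_of_not_cross Y U he
    rw [timeReflect_apply, timeReflect_apply, hVe]
  -- mirrors of time-like links at `t ≠ 0` and of spatial links are not crossing
  have hmirror_t : ∀ y : Site d L, (y 0).val ≠ 0 →
      ¬ (Prod.snd (edgeReflect ((y, (0 : Fin d)) : Edge d L)) = 0 ∧
        ZMod.val (Prod.fst (edgeReflect ((y, (0 : Fin d)) : Edge d L)) 0) = 0) := by
    intro y hy
    unfold edgeReflect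
    simp only [↓reduceIte, true_and]
    rw [val_timeReflect_shift_zero, if_neg hy]
    have := ZMod.val_lt (y 0)
    omega
  have hmirror_s : ∀ (y : Site d L) (k : Fin d), k ≠ 0 →
      ¬ (Prod.snd (edgeReflect ((y, k) : Edge d L)) = 0 ∧
        ZMod.val (Prod.fst (edgeReflect ((y, k) : Edge d L)) 0) = 0) := by
    intro y k hk
    unfold edgeReflect
    simp only [hk, ↓reduceIte, false_and, not_false_eq_true]
  unfold plaqRe plaquetteHolonomy
  simp only
  have hxj : ((x.shift j) 0).val = (x 0).val := val_shift_of_ne x (Ne.symm hj)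
  by_cases hi : i = 0
  · subst hi
    rw [hagree (x, 0) (hmirror_t x (by omega)), hagree (x.shift 0, j) (hmirror_s _ j hj),
      hagree (x.shift j, 0) (hmirror_t _ (by rw [hxj]; omega)), hagree (x, j) (hmirror_s _ j hj)]
  · rw [hagree (x, i) (hmirror_s _ i hi), hagree (x.shift i, j) (hmirror_s _ j hj),
      hagree (x.shift j, i) (hmirror_s _ i hi), hagree (x, j) (hmirror_s _ j hj)]

omit [Fact (1 < L)] [TopologicalSpace G] [IsTopologicalGroup G] [CompactSpace G] [MeasurableSpace G]
  [BorelSpace G] in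
/-- **The shared part `A_M` depends only on the links of `M`.** [folklore] -/
theorem sumM_congr_of_agree_M {V V' : GaugeConfig d L G}
    (hVV' : ∀ e ∈ ((Finset.univ.filter fun e : Edge d L =>
        Prod.snd e ≠ 0 ∧ ZMod.val (Prod.fst e 0) = L / 2 + 1) : Set (Edge d L)), V e = V' e) :
    ∑ p ∈ Finset.univ.filter (fun p : Plaquette d L =>
        Prod.fst (Subtype.val (Prod.snd p)) ≠ 0 ∧ ZMod.val (Prod.fst p 0) = L / 2 + 1), plaqRe ρ V p =
      ∑ p ∈ Finset.univ.filter (fun p : Plaquette d L =>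
        Prod.fst (Subtype.val (Prod.snd p)) ≠ 0 ∧ ZMod.val (Prod.fst p 0) = L / 2 + 1), plaqRe ρ V' p := by
  have hmem : ∀ (y : Site d L) (i : Fin d), i ≠ 0 → (y 0).val = L / 2 + 1 → V (y, i) = V' (y, i) :=
    fun y i hi hy => hVV' _ (by rw [Finset.mem_coe, Finset.mem_filter]; exact ⟨Finset.mem_univ _, hi, hy⟩)
  refine Finset.sum_congr rfl fun p hp => ?_
  rw [Finset.mem_filter] at hp
  obtain ⟨-, hi, ht⟩ := hp
  obtain ⟨x, ⟨⟨i, j⟩, hij⟩⟩ := p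
  have hj : j ≠ 0 := plaq_snd_ne_zero (x, ⟨(i, j), hij⟩)
  simp only at ht hi hj
  unfold plaqRe plaquetteHolonomy
  simp only
  have hxj : ((x.shift j) 0).val = (x 0).val := val_shift_of_ne x (Ne.symm hj)
  have hxi : ((x.shift i) 0).val = (x 0).val := val_shift_of_ne x (Ne.symm hi)
  rw [hmem x i hi ht, hmem (x.shift i) j hj (by rw [hxi]; exact ht),
    hmem (x.shift j) i hi (by rw [hxj]; exact ht), hmem x j hj ht]

omit [Fact (1 < L)] [TopologicalSpace G] [IsTopologicalGroup G] [CompactSpace G] [MeasurableSpace G]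
  [BorelSpace G] in
/-- **`A_M` is reflection invariant on the odd torus.** [folklore] -/
theorem sumM_timeReflect_odd (hL : Odd L) (V : GaugeConfig d L G) :
    ∑ p ∈ Finset.univ.filter (fun p : Plaquette d L =>
        Prod.fst (Subtype.val (Prod.snd p)) ≠ 0 ∧ ZMod.val (Prod.fst p 0) = L / 2 + 1),
        plaqRe ρ V.timeReflect p =
      ∑ p ∈ Finset.univ.filter (fun p : Plaquette d L =>
        Prod.fst (Subtype.val (Prod.snd p)) ≠ 0 ∧ ZMod.val (Prod.fst p 0) = L / 2 + 1), plaqRe ρ V p :=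
  sumM_congr_of_agree_M ρ fun e he => timeReflect_apply_of_mem_M_odd hL V e he

omit [TopologicalSpace G] [IsTopologicalGroup G] [CompactSpace G] [MeasurableSpace G] [BorelSpace G] in
/-- **The positive part `A` depends only on the links of `P ∪ C ∪ M`** (in fact of `P ∪ M`).
[folklore] -/
theorem sumPos_congr_of_agree (hL : Odd L) {V V' : GaugeConfig d L G}
    (hVV' : ∀ e ∈ (((Finset.univ.filter fun e : Edge d L =>
        1 ≤ ZMod.val (Prod.fst e 0) ∧ ZMod.val (Prod.fst e 0) ≤ L / 2) ∪
      (Finset.univ.filter fun e : Edge d L => Prod.snd e = 0 ∧ ZMod.val (Prod.fst e 0) = 0) ∪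
      (Finset.univ.filter fun e : Edge d L =>
        Prod.snd e ≠ 0 ∧ ZMod.val (Prod.fst e 0) = L / 2 + 1) : Finset (Edge d L)) : Set (Edge d L)),
        V e = V' e) :
    ∑ p ∈ Finset.univ.filter (fun p : Plaquette d L =>
        1 ≤ ZMod.val (Prod.fst p 0) ∧ ZMod.val (Prod.fst p 0) ≤ L / 2), plaqRe ρ V p =
      ∑ p ∈ Finset.univ.filter (fun p : Plaquette d L =>
        1 ≤ ZMod.val (Prod.fst p 0) ∧ ZMod.val (Prod.fst p 0) ≤ L / 2), plaqRe ρ V' p := by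
  have hO := Nat.odd_iff.mp hL
  -- a link with `1 ≤ t ≤ L/2`, or spatial with `t = L/2 + 1`, is in the union
  have hmem : ∀ (y : Site d L) (i : Fin d),
      ((1 ≤ (y 0).val ∧ (y 0).val ≤ L / 2) ∨ (i ≠ 0 ∧ (y 0).val = L / 2 + 1)) → V (y, i) = V' (y, i) := by
    intro y i hy
    apply hVV'
    rw [Finset.coe_union, Finset.coe_union, Set.mem_union, Set.mem_union, Finset.mem_coe,
      Finset.mem_coe, Finset.mem_coe, Finset.mem_filter, Finset.mem_filter, Finset.mem_filter]
    rcases hy with hy | hy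
    · exact Or.inl (Or.inl ⟨Finset.mem_univ _, hy⟩)
    · exact Or.inr ⟨Finset.mem_univ _, hy⟩
  refine Finset.sum_congr rfl fun p hp => ?_
  rw [Finset.mem_filter] at hp
  obtain ⟨-, ht1, ht2⟩ := hp
  obtain ⟨x, ⟨⟨i, j⟩, hij⟩⟩ := p
  have hj : j ≠ 0 := plaq_snd_ne_zero (x, ⟨(i, j), hij⟩)
  have hlt := ZMod.val_lt (x 0)
  simp only at ht1 ht2 hj
  unfold plaqRe plaquetteHolonomy
  simp only
  have hxj : ((x.shift j) 0).val = (x 0).val := val_shift_of_ne x (Ne.symm hj)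
  by_cases hi : i = 0
  · subst hi
    have hx0 : ((x.shift 0) 0).val = (x 0).val + 1 := by
      rw [WilsonRP.val_shift_self, if_neg (by omega)]
    rw [hmem x 0 (Or.inl ⟨ht1, ht2⟩), hmem (x.shift 0) j (by
        rw [hx0]; exact if h : (x 0).val + 1 ≤ L / 2 then Or.inl ⟨by omega, h⟩ else Or.inr ⟨hj, by omega⟩),
      hmem (x.shift j) 0 (Or.inl (by rw [hxj]; exact ⟨ht1, ht2⟩)), hmem x j (Or.inl ⟨ht1, ht2⟩)]
  · have hxi : ((x.shift i) 0).val = (x 0).val := val_shift_of_ne x (Ne.symm hi)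
    rw [hmem x i (Or.inl ⟨ht1, ht2⟩), hmem (x.shift i) j (Or.inl (by rw [hxi]; exact ⟨ht1, ht2⟩)),
      hmem (x.shift j) i (Or.inl (by rw [hxj]; exact ⟨ht1, ht2⟩)), hmem x j (Or.inl ⟨ht1, ht2⟩)]

omit [Fact (1 < L)] [TopologicalSpace G] [IsTopologicalGroup G] [CompactSpace G] [MeasurableSpace G]
  [BorelSpace G] in
/-- **The shared part `A_M` depends only on `P ∪ C ∪ M`** (in fact of `M`). [folklore] -/
theorem sumM_congr_of_agree {V V' : GaugeConfig d L G}
    (hVV' : ∀ e ∈ (((Finset.univ.filter fun e : Edge d L =>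
        1 ≤ ZMod.val (Prod.fst e 0) ∧ ZMod.val (Prod.fst e 0) ≤ L / 2) ∪
      (Finset.univ.filter fun e : Edge d L => Prod.snd e = 0 ∧ ZMod.val (Prod.fst e 0) = 0) ∪
      (Finset.univ.filter fun e : Edge d L =>
        Prod.snd e ≠ 0 ∧ ZMod.val (Prod.fst e 0) = L / 2 + 1) : Finset (Edge d L)) : Set (Edge d L)),
        V e = V' e) :
    ∑ p ∈ Finset.univ.filter (fun p : Plaquette d L =>
        Prod.fst (Subtype.val (Prod.snd p)) ≠ 0 ∧ ZMod.val (Prod.fst p 0) = L / 2 + 1), plaqRe ρ V p =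
      ∑ p ∈ Finset.univ.filter (fun p : Plaquette d L =>
        Prod.fst (Subtype.val (Prod.snd p)) ≠ 0 ∧ ZMod.val (Prod.fst p 0) = L / 2 + 1), plaqRe ρ V' p := by
  refine sumM_congr_of_agree_M ρ fun e he => hVV' e ?_
  rw [Finset.coe_union, Set.mem_union]
  exact Or.inr he

end OffCross

/-! ### The crossing plaquettes after the splitting: Gram form -/

section Gram

omit [Fact (1 < L)] [MeasurableSpace G] [BorelSpace G] in
/-- **The crossing identity on the odd torus.** For a crossing plaquette `p` (time-like,
`t = 0`) and `V = tL(Y, U)`: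
`Re tr ρ(V_p) = ∑_{k,l} Re (σ(ω_p(z))_{kl} conj σ(ω_p(ΘU))_{kl})`, `σ` the unitarised
representation, `ω_p` Wave 0's half plaquette `WilsonRP.halfPlaq` and `z = splice_C(U, Y)`
(the lower-crossing case of `WilsonRP.plaqRe_translate_of_isCrossPlaq`, whose proof is
followed). [folklore] -/
theorem plaqRe_translateLower_of_cross (hρ : Continuous ρ) (U Y : GaugeConfig d L G)
    {p : Plaquette d L} (hp : p.2.1.1 = 0 ∧ (p.1 0).val = 0) :
    plaqRe ρ (fun e' : Edge d L =>
        U e' * (if Prod.snd e' = 0 ∧ ZMod.val (Prod.fst e' 0) = 0 then Y e' else 1)) p =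
      ∑ k, ∑ l, (CompactGroup.unitarize ρ hρ (halfPlaq p (LatticeRP.splice
          (Finset.univ.filter fun e : Edge d L => Prod.snd e = 0 ∧ ZMod.val (Prod.fst e 0) = 0) (U, Y))) k l *
        conj (CompactGroup.unitarize ρ hρ (halfPlaq p U.timeReflect) k l)).re := by
  obtain ⟨x, ⟨⟨i, j⟩, hij⟩⟩ := p
  obtain ⟨hi, ht⟩ := hp
  simp only at hi ht
  subst hi
  have hj : j ≠ 0 := plaq_snd_ne_zero (x, ⟨(0, j), hij⟩)
  have hx0 : x 0 = 0 := (ZMod.val_eq_zero _).1 ht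
  have h2 : x 0 + x 0 = 0 := by rw [hx0, add_zero]
  have hxj : ((x.shift j) 0).val = 0 := by rw [val_shift_of_ne x (Ne.symm hj)]; exact ht
  have h2j : (x.shift j) 0 + (x.shift j) 0 = 0 := by rw [shift_apply_of_ne _ (Ne.symm hj)]; exact h2
  have hΘ1 : U.timeReflect (x, 0) = (U (x, 0))⁻¹ := by
    rw [timeReflect_apply]
    simp only [edgeReflect, ↓reduceIte, timeReflect_shift_of_two_mul h2]
  have hΘ2 : U.timeReflect (x.shift 0, j) = U (x, j) := by
    rw [timeReflect_apply]
    simp only [edgeReflect, hj, ↓reduceIte, timeReflect_shift_of_two_mul h2]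
  have hΘ3 : U.timeReflect (x.shift j, 0) = (U (x.shift j, 0))⁻¹ := by
    rw [timeReflect_apply]
    simp only [edgeReflect, ↓reduceIte, timeReflect_shift_of_two_mul h2j]
  have hc1 : Prod.snd ((x, (0 : Fin d)) : Edge d L) = 0 ∧ ZMod.val (Prod.fst ((x, (0 : Fin d)) : Edge d L) 0) = 0 :=
    ⟨rfl, ht⟩
  have hc3 : Prod.snd ((x.shift j, (0 : Fin d)) : Edge d L) = 0 ∧
      ZMod.val (Prod.fst ((x.shift j, (0 : Fin d)) : Edge d L) 0) = 0 := ⟨rfl, hxj⟩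
  have hn2 : ¬ (Prod.snd ((x.shift 0, j) : Edge d L) = 0 ∧ ZMod.val (Prod.fst ((x.shift 0, j) : Edge d L) 0) = 0) :=
    fun h => hj h.1
  have hn4 : ¬ (Prod.snd ((x, j) : Edge d L) = 0 ∧ ZMod.val (Prod.fst ((x, j) : Edge d L) 0) = 0) :=
    fun h => hj h.1
  set V : GaugeConfig d L G := (fun e' : Edge d L =>
    U e' * (if Prod.snd e' = 0 ∧ ZMod.val (Prod.fst e' 0) = 0 then Y e' else 1)) with hV
  have v1 : V (x, 0) = U (x, 0) * Y (x, 0) := by rw [hV]; exact translateLower_apply_of_cross Y U hc1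
  have v2 : V (x.shift 0, j) = U (x.shift 0, j) := by rw [hV]; exact translateLower_apply_of_not_cross Y U hn2
  have v3 : V (x.shift j, 0) = U (x.shift j, 0) * Y (x.shift j, 0) := by
    rw [hV]; exact translateLower_apply_of_cross Y U hc3
  have v4 : V (x, j) = U (x, j) := by rw [hV]; exact translateLower_apply_of_not_cross Y U hn4
  unfold plaqRe plaquetteHolonomy halfPlaq
  simp only
  rw [if_pos ht, if_pos ht, v1, v2, v3, v4,
    spliceLower_apply_of_cross U Y hc1, spliceLower_apply_of_not_cross U Y hn2,
    spliceLower_apply_of_cross U Y hc3, hΘ1, hΘ2, hΘ3]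
  rw [show U (x, 0) * Y (x, 0) * U (x.shift 0, j) * (U (x.shift j, 0) * Y (x.shift j, 0))⁻¹ *
        (U (x, j))⁻¹ = U (x, 0) * ((Y (x, 0) * U (x.shift 0, j) * (Y (x.shift j, 0))⁻¹) *
        ((U (x, 0))⁻¹ * U (x, j) * ((U (x.shift j, 0))⁻¹)⁻¹)⁻¹) * (U (x, 0))⁻¹ by group,
    CompactGroup.trace_conj_eq, CompactGroup.re_trace_mul_inv_eq_sum ρ hρ]

omit [Fact (1 < L)] [MeasurableSpace G] [BorelSpace G] in
/-- **The crossing Boltzmann weight on the odd torus is a Gram kernel**: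
`∑ᵢ aᵢ(z) conj aᵢ(ΘU) = β X(tL(Y, U))` with the coefficient functions
`aᵢ = √(β/2) σ(ω_p)_{kl}` / `√(β/2) conj σ(ω_p)_{kl}` for crossing `p = i.1` and `0` otherwise
(written explicitly). [folklore] -/
theorem sum_coeffLower_mul_conj (hρ : Continuous ρ) {β : ℝ} (hβ : 0 ≤ β) (U Y : GaugeConfig d L G) :
    ∑ i : CoeffIndex d L N,
        (fun (i : CoeffIndex d L N) (V : GaugeConfig d L G) =>
          if Prod.fst (Subtype.val (Prod.snd (Prod.fst i))) = 0 ∧ ZMod.val (Prod.fst (Prod.fst i) 0) = 0 then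
            (Real.sqrt (β / 2) : ℂ) *
              (if i.2.2.2 then CompactGroup.unitarize ρ hρ (halfPlaq i.1 V) i.2.1 i.2.2.1
                else conj (CompactGroup.unitarize ρ hρ (halfPlaq i.1 V) i.2.1 i.2.2.1))
          else 0) i (LatticeRP.splice
            (Finset.univ.filter fun e : Edge d L => Prod.snd e = 0 ∧ ZMod.val (Prod.fst e 0) = 0) (U, Y)) *
        conj ((fun (i : CoeffIndex d L N) (V : GaugeConfig d L G) =>
          if Prod.fst (Subtype.val (Prod.snd (Prod.fst i))) = 0 ∧ ZMod.val (Prod.fst (Prod.fst i) 0) = 0 then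
            (Real.sqrt (β / 2) : ℂ) *
              (if i.2.2.2 then CompactGroup.unitarize ρ hρ (halfPlaq i.1 V) i.2.1 i.2.2.1
                else conj (CompactGroup.unitarize ρ hρ (halfPlaq i.1 V) i.2.1 i.2.2.1))
          else 0) i U.timeReflect) =
      ((β * ∑ p ∈ Finset.univ.filter (fun p : Plaquette d L =>
          Prod.fst (Subtype.val (Prod.snd p)) = 0 ∧ ZMod.val (Prod.fst p 0) = 0),
          plaqRe ρ (fun e' : Edge d L =>
            U e' * (if Prod.snd e' = 0 ∧ ZMod.val (Prod.fst e' 0) = 0 then Y e' else 1)) p : ℝ) : ℂ) := by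
  have hs : (Real.sqrt (β / 2) : ℂ) * (Real.sqrt (β / 2) : ℂ) = ((β / 2 : ℝ) : ℂ) := by
    rw [← Complex.ofReal_mul, Real.mul_self_sqrt (by linarith)]
  rw [Finset.mul_sum, Complex.ofReal_sum, Finset.sum_filter, Fintype.sum_prod_type]
  refine Finset.sum_congr rfl fun p _ => ?_
  by_cases hp : Prod.fst (Subtype.val (Prod.snd p)) = 0 ∧ ZMod.val (Prod.fst p 0) = 0
  · rw [if_pos hp, plaqRe_translateLower_of_cross ρ hρ U Y hp, Finset.mul_sum, Complex.ofReal_sum,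
      Fintype.sum_prod_type]
    refine Finset.sum_congr rfl fun k _ => ?_
    rw [Finset.mul_sum, Complex.ofReal_sum, Fintype.sum_prod_type]
    refine Finset.sum_congr rfl fun l _ => ?_
    rw [Fintype.sum_bool]
    simp only [if_pos hp, ↓reduceIte, Bool.false_eq_true, map_mul, Complex.conj_ofReal,
      Complex.conj_conj]
    set u := CompactGroup.unitarize ρ hρ (halfPlaq p (LatticeRP.splice
      (Finset.univ.filter fun e : Edge d L => Prod.snd e = 0 ∧ ZMod.val (Prod.fst e 0) = 0) (U, Y))) k l
    set v := CompactGroup.unitarize ρ hρ (halfPlaq p U.timeReflect) k l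
    calc (Real.sqrt (β / 2) : ℂ) * u * ((Real.sqrt (β / 2) : ℂ) * conj v) +
          (Real.sqrt (β / 2) : ℂ) * conj u * ((Real.sqrt (β / 2) : ℂ) * v)
        = ((Real.sqrt (β / 2) : ℂ) * (Real.sqrt (β / 2) : ℂ)) * (u * conj v + conj (u * conj v)) := by
          simp only [map_mul, Complex.conj_conj]; ring
      _ = ((β * (u * conj v).re : ℝ) : ℂ) := by
          rw [hs, Complex.add_conj]; push_cast; ring
  · simp only [hp, ↓reduceIte, zero_mul, Finset.sum_const_zero]

end Gram


/-! ### The coefficient functions: measurability, bounds, dependence -/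

section Coeff

omit [NeZero L] [Fact (1 < L)] in
/-- The coefficient functions are measurable. [folklore] -/
theorem measurable_coeffLower (hρ : Continuous ρ) (β : ℝ) (i : CoeffIndex d L N) :
    Measurable ((fun (i : CoeffIndex d L N) (V : GaugeConfig d L G) =>
      if Prod.fst (Subtype.val (Prod.snd (Prod.fst i))) = 0 ∧ ZMod.val (Prod.fst (Prod.fst i) 0) = 0 then
        (Real.sqrt (β / 2) : ℂ) *
          (if i.2.2.2 then CompactGroup.unitarize ρ hρ (halfPlaq i.1 V) i.2.1 i.2.2.1
            else conj (CompactGroup.unitarize ρ hρ (halfPlaq i.1 V) i.2.1 i.2.2.1))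
      else 0) i) := by
  by_cases hp : Prod.fst (Subtype.val (Prod.snd (Prod.fst i))) = 0 ∧ ZMod.val (Prod.fst (Prod.fst i) 0) = 0
  · simp only [if_pos hp]
    have hω := entryMeasurable_halfPlaq ρ hρ i.1 (G := G)
    by_cases hs : i.2.2.2 = true
    · simp only [hs, ↓reduceIte]
      exact (hω _ _).const_mul _
    · simp only [hs, Bool.false_eq_true, ↓reduceIte]
      exact (Complex.continuous_conj.measurable.comp (hω _ _)).const_mul _
  · simp only [if_neg hp]
    exact measurable_const

omit [NeZero L] [Fact (1 < L)] [MeasurableSpace G] [BorelSpace G] in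
/-- The coefficient functions are bounded by `√(β/2)`. [folklore] -/
theorem norm_coeffLower_le (hρ : Continuous ρ) (β : ℝ) (i : CoeffIndex d L N) (V : GaugeConfig d L G) :
    ‖(fun (i : CoeffIndex d L N) (V : GaugeConfig d L G) =>
      if Prod.fst (Subtype.val (Prod.snd (Prod.fst i))) = 0 ∧ ZMod.val (Prod.fst (Prod.fst i) 0) = 0 then
        (Real.sqrt (β / 2) : ℂ) *
          (if i.2.2.2 then CompactGroup.unitarize ρ hρ (halfPlaq i.1 V) i.2.1 i.2.2.1
            else conj (CompactGroup.unitarize ρ hρ (halfPlaq i.1 V) i.2.1 i.2.2.1))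
      else 0) i V‖ ≤ Real.sqrt (β / 2) := by
  simp only
  split_ifs with hp hs
  · rw [norm_mul, Complex.norm_real, Real.norm_eq_abs, abs_of_nonneg (Real.sqrt_nonneg _)]
    exact mul_le_of_le_one_right (Real.sqrt_nonneg _)
      (CompactGroup.norm_unitarize_apply_le_one ρ hρ _ _ _)
  · rw [norm_mul, Complex.norm_real, Real.norm_eq_abs, abs_of_nonneg (Real.sqrt_nonneg _),
      Complex.norm_conj]
    exact mul_le_of_le_one_right (Real.sqrt_nonneg _)
      (CompactGroup.norm_unitarize_apply_le_one ρ hρ _ _ _)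
  · rw [norm_zero]
    exact Real.sqrt_nonneg _

omit [TopologicalSpace G] [IsTopologicalGroup G] [CompactSpace G] [MeasurableSpace G] [BorelSpace G] in
/-- The half plaquette of a crossing plaquette depends only on links in `P ∪ C ∪ M` (its three
links are two crossing links and a spatial link of the slice `1`). [folklore] -/
theorem halfPlaq_congr_odd {p : Plaquette d L} (hp : p.2.1.1 = 0 ∧ (p.1 0).val = 0)
    {U V : GaugeConfig d L G}
    (hUV : ∀ e ∈ (((Finset.univ.filter fun e : Edge d L =>
        1 ≤ ZMod.val (Prod.fst e 0) ∧ ZMod.val (Prod.fst e 0) ≤ L / 2) ∪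
      (Finset.univ.filter fun e : Edge d L => Prod.snd e = 0 ∧ ZMod.val (Prod.fst e 0) = 0) ∪
      (Finset.univ.filter fun e : Edge d L =>
        Prod.snd e ≠ 0 ∧ ZMod.val (Prod.fst e 0) = L / 2 + 1) : Finset (Edge d L)) : Set (Edge d L)),
        U e = V e) :
    halfPlaq p U = halfPlaq p V := by
  have h1L : 1 < L := Fact.out
  obtain ⟨x, ⟨⟨i, j⟩, hij⟩⟩ := p
  obtain ⟨hi, ht⟩ := hp
  simp only at hi ht
  subst hi
  have hj : j ≠ 0 := plaq_snd_ne_zero (x, ⟨(0, j), hij⟩)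
  have hP : ∀ e : Edge d L, 1 ≤ ZMod.val (Prod.fst e 0) ∧ ZMod.val (Prod.fst e 0) ≤ L / 2 → U e = V e := by
    intro e he
    apply hUV
    rw [Finset.coe_union, Finset.coe_union, Set.mem_union, Set.mem_union, Finset.mem_coe,
      Finset.mem_filter]
    exact Or.inl (Or.inl ⟨Finset.mem_univ _, he⟩)
  have hC : ∀ e : Edge d L, Prod.snd e = 0 ∧ ZMod.val (Prod.fst e 0) = 0 → U e = V e := by
    intro e he
    apply hUV
    rw [Finset.coe_union, Finset.coe_union, Set.mem_union, Set.mem_union, Finset.mem_coe,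
      Finset.mem_coe, Finset.mem_filter, Finset.mem_filter]
    exact Or.inl (Or.inr ⟨Finset.mem_univ _, he⟩)
  have hx1 : ((x.shift 0) 0).val = 1 := by
    rw [WilsonRP.val_shift_self, ht, if_neg (by omega)]
  have hxj : ((x.shift j) 0).val = 0 := by rw [val_shift_of_ne x (Ne.symm hj)]; exact ht
  unfold halfPlaq
  simp only
  rw [if_pos ht, if_pos ht, hC (x, 0) ⟨rfl, ht⟩, hP (x.shift 0, j) (by simp only [hx1]; omega),
    hC (x.shift j, 0) ⟨rfl, hxj⟩]

omit [MeasurableSpace G] [BorelSpace G] in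
/-- The coefficient functions depend only on the links in `P ∪ C ∪ M`. [folklore] -/
theorem dependsOn_coeffLower (hρ : Continuous ρ) (β : ℝ) (i : CoeffIndex d L N) :
    DependsOn ((fun (i : CoeffIndex d L N) (V : GaugeConfig d L G) =>
      if Prod.fst (Subtype.val (Prod.snd (Prod.fst i))) = 0 ∧ ZMod.val (Prod.fst (Prod.fst i) 0) = 0 then
        (Real.sqrt (β / 2) : ℂ) *
          (if i.2.2.2 then CompactGroup.unitarize ρ hρ (halfPlaq i.1 V) i.2.1 i.2.2.1
            else conj (CompactGroup.unitarize ρ hρ (halfPlaq i.1 V) i.2.1 i.2.2.1))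
      else 0) i)
      (((Finset.univ.filter fun e : Edge d L =>
        1 ≤ ZMod.val (Prod.fst e 0) ∧ ZMod.val (Prod.fst e 0) ≤ L / 2) ∪
      (Finset.univ.filter fun e : Edge d L => Prod.snd e = 0 ∧ ZMod.val (Prod.fst e 0) = 0) ∪
      (Finset.univ.filter fun e : Edge d L =>
        Prod.snd e ≠ 0 ∧ ZMod.val (Prod.fst e 0) = L / 2 + 1) : Finset (Edge d L)) : Set (Edge d L)) := by
  intro U V hUV
  simp only
  by_cases hp : Prod.fst (Subtype.val (Prod.snd (Prod.fst i))) = 0 ∧ ZMod.val (Prod.fst (Prod.fst i) 0) = 0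
  · simp only [if_pos hp, halfPlaq_congr_odd hp hUV]
  · simp only [if_neg hp]

end Coeff

end StringTension

end Literature.MathematicalPhysics.QuantumFieldTheory
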